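import Summits.BirchSwinnertonDyer.Rank1Residual.Additive.GordGreenbergKummerIdentification
import Summits.BirchSwinnertonDyer.Rank1Residual.Additive.CongruentLambdaShiftOfGVTorsionIso
import Summits.BirchSwinnertonDyer.Rank1Residual.Additive.BudgetFromRationalClasses
import Literature.NumberTheory.EllipticCurves.KummerMap
import HarnessLib

/-!
# `E₁[p] ≅ E₂[p]` as Galois modules ⟹ (`p ∣ #E₁(ℚ)_tors ↔ p ∣ #E₂(ℚ)_tors`), and the X3♯(G-ord)
# congruent-pair node of Route G with ONE census torsion binder and BOTH R-D binders discharged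
# (cell `b2b-bsdres`, lane CLASS-CLOSURE, seat cc-typer-2 = typer of record N10 §3.2 / O7 §3.3;
# team n1011, ROUTE-2 II.15.4 ARM α; closes TODO (2) of the seat's record A240)

HONEST FRAMING (cell `b2b-bsdres`, run/shared/lean/b2b/bsd-rank1-residual/, verbatim in every file):
the goal of the cell is to DELETE the COMBINATION-SHAPED residual classes of the Birch–Swinnerton-Dyer
formula for ALL analytic-rank `≤ 1` elliptic curves over `ℚ` — "full BSD formula for every rank `≤ 1`
curve in class `C`" assembled STRICTLY from published theorems — so that the rank-`≤ 1` remainder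
becomes exactly the CONSTRUCTION-SHAPED classes, which are TYPED (missing-input `Prop`s), NOT
attempted. This is not "finishing BSD". Lane CLASS-CLOSURE: prove what is provable now; shrink each
hard class to its core with data; no claim beyond stated classes; census output = EVIDENCE, never a
Literature fact; RESIDUAL-MAP marks UNCHANGED; nothing is booked by this file. THEOREMS ONLY: no
definition, no named fact (D-0026).

## What

§1 (folklore, kernel): for elliptic curves `E₁, E₂` over a number field `K` and a prime `p`, a
`Γ_K`-equivariant additive isomorphism `E₁[p] ≃ E₂[p]` of the geometric `p`-torsion carries
`E₁(K)[p] = E₁[p]^{Γ_K}` onto `E₂(K)[p]`, so `p ∣ #E₁(K)_tors ⟹ p ∣ #E₂(K)_tors`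
(`dvd_torsionOrder_of_equivariant_addEquiv`); over `ℚ`, for Route G's `TorsionIso W₁ W₂ p`:
**`p ∣ #E₁(ℚ)_tors ↔ p ∣ #E₂(ℚ)_tors`** (`dvd_torsionOrder_iff_of_torsionIso`). Proof, all tree
lemmas: `p ∣ #E₁(K)_tors` gives a rational point `T` of order `p` (Cauchy in the finite group
`E₁(K)_tors`, `finite_torsion_point`); its image in `E₁(K̄)` is a non-zero `Γ_K`-fixed element of
`E₁[p]` (`smul_toGeomPoints`, `toGeomPoints_injective`); its image under the isomorphism is a non-zero
`Γ_K`-fixed element of `E₂[p]`, which descends to a non-zero rational point killed by `p` (Galois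
descent over the perfect field `K`, `exists_toGeomPoints_eq_of_forall_smul_eq`), whence
`p ∣ #E₂(K)_tors` (`forall_smul_eq_zero_of_not_dvd_torsionOrder`). This is the item "the derivation of
`p ∤ #E₂(ℚ)_tors` from `p ∤ #E₁(ℚ)_tors` and the isomorphism" left as `TODO` in the module
docstring of the seat's record A240
`GreenbergVatsal2000.muLambdaAlg_transfer_of_torsionIso_potOrd_of_not_dvd_torsionOrder` (GV p. 26:
"`H⁰(ℚ, Aᵢ[π]) = 0`" is ONE condition for a congruent pair, not two).

§2 (bookkeeping over landed theorems): the X3♯(G-ord) ∩ `I₀*` congruent-pair node of Route G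
(`ClassX3Gord.congruentLambdaShift_of_gv_of_torsionIso` / `…mu_eq_zero_of_gv_of_torsionIso`, this
seat, `Additive/CongruentLambdaShiftOfGVTorsionIso.lean`) with (i) the second torsion binder
DERIVED from the first by §1 and (ii) BOTH R-D binders `hRDᵢ : RamifiedLineKummerEqAt Wᵢ p`
DISCHARGED modulo the ONE typed published fact A239 `hGrK`
(`Greenberg1999.imKummer_ge_strictCondition_goodOrdinary`) by n1011-p05's row T-RD-Δ-K file F8
`ClassX3Gord.ramifiedLineKummerEqAt (hGrK) (hp2) (hX) (he)` — so on an X3♯(G-ord) pair at an odd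
`p` the remaining inputs of the `λ`-shift / `μ = 0` transfer are exactly: the GV record `hGV` (A240,
composed citation), `hGrK` (A239), `TorsionIso W₁ W₂ p` (per-pair certificate: cc-eng-2 TISO-RED
exact engines), ONE census bit `p ∤ #E₁(ℚ)_tors`, and `Σ₀`. The X4♯(G-ord) twins carry no torsion
bit at all (irreducibility, `ClassX4Gord.not_dvd_torsionOrder`). These are the (G-ord)–(G-ord)
companions of n1011-p07's (M)–(M) and mixed forms (`AdditivePotMult/PotMultCongruentPairGV`,
`…/MixedCongruentPairGV`, row T-RD-M (iv)/(v)). X3♯(G-ord) / X4♯(G-ord) stay CONSTRUCTION-SHAPED;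
nothing booked; no mark moves.

References: [GreenbergVatsal2000] §2 Prop. (2.8), Remark (2.9), Cor. (2.3), Prop. (2.4), pp. 26–27
(arXiv:math/9906215); [GreenbergLNM1716] §2 Props. 2.2/2.4 (pp. 73–75); [Mazur1977] Ch. III §5
p. 157; [SilvermanAEC2009] VIII.§1; ROUTE-2 II.15.4 / II.19.1 (b) (cells/n1011/); n1011 PLAN R5-52.
-/

set_option autoImplicit false

noncomputable section

open scoped Classical NumberField

open NumberField IsDedekindDomain Field WeierstrassCurve
  Literature.NumberTheory.GaloisRepresentations
  Literature.NumberTheory.EllipticCurves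
  Literature.NumberTheory.EllipticCurves.Rank1Residual
  Literature.NumberTheory.EllipticCurves.GreenbergSelmer
  Literature.NumberTheory.EllipticCurves.Greenberg1999
  Literature.NumberTheory.EllipticCurves.GreenbergVatsal2000
  Literature.NumberTheory.EllipticCurves.EmertonPollackWeston2006
  Summit.BirchSwinnertonDyer.Rank1Residual.X1.CongruenceTransfer

namespace Summit.BirchSwinnertonDyer.Rank1Residual.Additive

/-! ## §1. Rational `p`-torsion is an invariant of the Galois module `E[p]` -/

section TorsionK

universe u

variable {K : Type u} [Field K] [NumberField K] {W₁ W₂ : WeierstrassCurve K} [W₁.IsElliptic]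
  [W₂.IsElliptic] {p : ℕ} [hp : Fact p.Prime]

omit [W₂.IsElliptic] in
/-- **A `Γ_K`-equivariant isomorphism `E₁[p] ≃ E₂[p]` transports rational `p`-torsion:
`p ∣ #E₁(K)_tors ⟹ p ∣ #E₂(K)_tors`** (`K` a number field). A `K`-rational point of order `p` on
`E₁` (Cauchy in the finite group `E₁(K)_tors`, tree `finite_torsion_point`) is a non-zero `Γ_K`-fixed
vector of `E₁[p]`; its image is a non-zero `Γ_K`-fixed vector of `E₂[p]`, i.e. (Galois descent, `K`
perfect, tree `exists_toGeomPoints_eq_of_forall_smul_eq`) a non-zero `K`-rational point of `E₂`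
killed by `p`. [folklore] [cite: SilvermanAEC2009, VIII.§1 (proof of Prop. 1.2: E(K̄)^{Γ_K} = E(K)) and §VIII.7] -/
theorem dvd_torsionOrder_of_equivariant_addEquiv
    (e : geomTorsion W₁ (p : ℤ) ≃+ geomTorsion W₂ (p : ℤ))
    (he : ∀ (σ : Field.absoluteGaloisGroup K) (P : geomTorsion W₁ (p : ℤ)), e (σ • P) = σ • e P)
    (h₁ : p ∣ W₁.torsionOrder) : p ∣ W₂.torsionOrder := by
  -- Cauchy in `E₁(K)_tors`
  haveI := W₁.finite_torsion_point
  unfold WeierstrassCurve.torsionOrder at h₁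
  obtain ⟨t, ht⟩ := exists_prime_addOrderOf_dvd_card' p h₁
  set T : W₁.toAffine.Point := (t : W₁.toAffine.Point) with hTdef
  have hT : addOrderOf T = p := (AddSubgroup.addOrderOf_coe t).trans ht
  have hT0 : T ≠ 0 := by
    intro h
    rw [h, addOrderOf_zero] at hT
    exact hp.out.one_lt.ne hT
  have hpT : p • T = 0 := by
    rw [← hT]
    exact addOrderOf_nsmul_eq_zero T
  -- the geometric point of `T`, a `Γ_K`-fixed non-zero element of `E₁[p]`
  have hQmem : toGeomPoints W₁ T ∈ geomTorsion W₁ (p : ℤ) := by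
    rw [mem_geomTorsion_iff, natCast_zsmul, ← map_nsmul, hpT, map_zero]
  set P₁ : geomTorsion W₁ (p : ℤ) := ⟨toGeomPoints W₁ T, hQmem⟩ with hP₁
  have hP₁fix : ∀ σ : Field.absoluteGaloisGroup K, σ • P₁ = P₁ := fun σ ↦
    Subtype.ext (by rw [AddSubgroup.torsionBy.coe_smul]; exact smul_toGeomPoints W₁ σ T)
  have hP₁ne : P₁ ≠ 0 := by
    intro h
    have h' : toGeomPoints W₁ T = 0 := congrArg Subtype.val h
    exact hT0 (toGeomPoints_injective W₁ (by rw [map_zero]; exact h'))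
  -- its image, a `Γ_K`-fixed non-zero element of `E₂[p]`
  have hP₂ne : e P₁ ≠ 0 := fun h ↦ hP₁ne (e.injective (by rw [h, map_zero]))
  have hP₂fix : ∀ σ : Field.absoluteGaloisGroup K,
      σ • ((e P₁ : geomTorsion W₂ (p : ℤ)) : geomPoints W₂) = (e P₁ : geomPoints W₂) := fun σ ↦ by
    rw [← AddSubgroup.torsionBy.coe_smul, ← he, hP₁fix]
  -- Galois descent to a `K`-rational point of `E₂` killed by `p`
  obtain ⟨T₂, hT₂⟩ := exists_toGeomPoints_eq_of_forall_smul_eq W₂ hP₂fix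
  have hT₂ne : T₂ ≠ 0 := by
    intro h
    apply hP₂ne
    apply Subtype.ext
    rw [ZeroMemClass.coe_zero, ← hT₂, h, map_zero]
  have hpT₂ : p • T₂ = 0 := by
    apply toGeomPoints_injective W₂
    rw [map_nsmul, hT₂, map_zero, ← natCast_zsmul]
    exact (mem_geomTorsion_iff W₂ (p : ℤ) _).mp (e P₁).2
  by_contra h₂
  exact hT₂ne (forall_smul_eq_zero_of_not_dvd_torsionOrder W₂ p h₂ T₂ hpT₂)

end TorsionK

section TorsionQ

variable {W₁ W₂ : WeierstrassCurve ℚ} [W₁.IsElliptic] [W₂.IsElliptic] {p : ℕ} [hp : Fact p.Prime]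

/-- **`TorsionIso W₁ W₂ p ⟹ (p ∣ #E₁(ℚ)_tors ↔ p ∣ #E₂(ℚ)_tors)`** (both directions of
`dvd_torsionOrder_of_equivariant_addEquiv`, the inverse isomorphism being equivariant,
`TorsionIso.symm`). [folklore] [cite: SilvermanAEC2009, VIII.§1 (proof of Prop. 1.2)] -/
theorem dvd_torsionOrder_iff_of_torsionIso (hT : TorsionIso W₁ W₂ p) :
    p ∣ W₁.torsionOrder ↔ p ∣ W₂.torsionOrder := by
  constructor
  · obtain ⟨e, he⟩ := hT
    exact dvd_torsionOrder_of_equivariant_addEquiv e he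
  · obtain ⟨e, he⟩ := hT.symm
    exact dvd_torsionOrder_of_equivariant_addEquiv e he

/-- **`TorsionIso W₁ W₂ p ∧ p ∤ #E₁(ℚ)_tors ⟹ p ∤ #E₂(ℚ)_tors`** — the form the GV record's second
torsion binder is fed with (GV p. 26 "`H⁰(ℚ, A[π]) = 0`" for `A₂` from the same for `A₁` and
`A₁[p] ≅ A₂[p]`). [folklore] [cite: GreenbergVatsal2000, §2 Prop. (2.8) and p. 26 (arXiv:math/9906215)] -/
theorem not_dvd_torsionOrder_of_torsionIso (hT : TorsionIso W₁ W₂ p)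
    (h₁ : ¬ p ∣ W₁.torsionOrder) : ¬ p ∣ W₂.torsionOrder :=
  fun h₂ ↦ h₁ ((dvd_torsionOrder_iff_of_torsionIso hT).mpr h₂)

/-- `ord_p #E₁(ℚ)_tors = 0 ↔ ord_p #E₂(ℚ)_tors = 0` for a congruent pair (the torsion term of the
Miller-currency BSD_p identity is `0` on both or neither). [folklore] -/
theorem padicValNat_torsionOrder_eq_zero_iff_of_torsionIso (hT : TorsionIso W₁ W₂ p) :
    padicValNat p W₁.torsionOrder = 0 ↔ padicValNat p W₂.torsionOrder = 0 := by
  rw [padicValNat.eq_zero_iff, padicValNat.eq_zero_iff, dvd_torsionOrder_iff_of_torsionIso hT]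
  have h₁ : W₁.torsionOrder ≠ 0 := (W₁.torsionOrder_pos_holds).ne'
  have h₂ : W₂.torsionOrder ≠ 0 := (W₂.torsionOrder_pos_holds).ne'
  simp only [h₁, h₂, hp.out.ne_one, false_or]

end TorsionQ

/-! ## §2. X3♯(G-ord) congruent pairs: ONE torsion bit, R-D mod `hGrK`; X4♯(G-ord): no torsion bit -/

section Classes

variable {p : ℕ} [hp : Fact p.Prime] {W₁ W₂ : WeierstrassCurve ℚ} [W₁.IsElliptic]
  [W₁.IsGloballyMinimal] [W₂.IsElliptic] [W₂.IsGloballyMinimal]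

/-- **X3♯(G-ord) ∩ `I₀*` congruent pairs, odd `p`: Route G's `CongruentLambdaShift W₁ W₂ p e`,
`e = Σ_{w∈Σ₀} (δ(E₂,w) − δ(E₁,w))`, from the GV record with ONE census torsion bit** (`p ∤ #E₁(ℚ)_tors`;
the bit for `E₂` follows from `TorsionIso`, §1) and the R-D binders still explicit.
X3♯(G-ord) stays CONSTRUCTION-SHAPED; nothing booked.
[cite: GreenbergVatsal2000, §2 Prop. (2.8) with Remark (2.9), Cor. (2.3), Prop. (2.4), pp. 26–27 (arXiv:math/9906215)] -/
theorem ClassX3Gord.congruentLambdaShift_of_gv_of_torsionIso₁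
    (hGV : muLambdaAlg_transfer_of_torsionIso_potOrd_of_not_dvd_torsionOrder) (hp2 : p ≠ 2)
    (hX₁ : ClassX3Gord W₁ p) (he₁ : semistabilityIndex W₁ p = 2)
    (hX₂ : ClassX3Gord W₂ p) (he₂ : semistabilityIndex W₂ p = 2)
    (htors₁ : ¬ p ∣ W₁.torsionOrder)
    (hRD₁ : RamifiedLineKummerEqAt W₁ p) (hRD₂ : RamifiedLineKummerEqAt W₂ p) (hT : TorsionIso W₁ W₂ p)
    (S₀ : Finset (HeightOneSpectrum (𝓞 ℚ))) (hS₀ : ∀ w ∈ S₀, ((p : ℕ) : 𝓞 ℚ) ∉ w.asIdeal)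
    (hS₁ : ∀ w : HeightOneSpectrum (𝓞 ℚ), w ∉ S₀ → ((p : ℕ) : 𝓞 ℚ) ∉ w.asIdeal →
      W₁.HasGoodReductionAt w)
    (hS₂ : ∀ w : HeightOneSpectrum (𝓞 ℚ), w ∉ S₀ → ((p : ℕ) : 𝓞 ℚ) ∉ w.asIdeal →
      W₂.HasGoodReductionAt w) :
    CongruentLambdaShift W₁ W₂ p (∑ w ∈ S₀, ((delta W₂ p w : ℤ) - (delta W₁ p w : ℤ))) :=
  ClassX3Gord.congruentLambdaShift_of_gv_of_torsionIso hGV hp2 hX₁ he₁ hX₂ he₂ htors₁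
    (not_dvd_torsionOrder_of_torsionIso hT htors₁) hRD₁ hRD₂ hT S₀ hS₀ hS₁ hS₂

/-- **X3♯(G-ord) ∩ `I₀*` congruent pairs, odd `p`, EVERY binder of the GV record discharged except the
two typed published facts and the per-pair data**: `CongruentLambdaShift W₁ W₂ p (Σ_{w∈Σ₀} (δ(E₂,w) −
δ(E₁,w)))` from `hGV` (A240), `hGrK` (A239, through n1011-p05's `ClassX3Gord.ramifiedLineKummerEqAt`),
the two class columns, `TorsionIso W₁ W₂ p`, ONE census bit `p ∤ #E₁(ℚ)_tors`, and `Σ₀ ∌ p` outside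
which both curves are good. The (G-ord)–(G-ord) companion of n1011-p07's (M)–(M) / mixed forms.
X3♯(G-ord) stays CONSTRUCTION-SHAPED; nothing booked.
[cite: GreenbergVatsal2000, §2 Prop. (2.8) with Remark (2.9), Cor. (2.3), Prop. (2.4), pp. 26–27 (arXiv:math/9906215)]
[cite: GreenbergLNM1716, §2 Props. 2.2, 2.4 (pp. 73–75)] -/
theorem ClassX3Gord.congruentLambdaShift_of_gv_of_grK_of_torsionIso
    (hGV : muLambdaAlg_transfer_of_torsionIso_potOrd_of_not_dvd_torsionOrder)
    (hGrK : imKummer_ge_strictCondition_goodOrdinary) (hp2 : p ≠ 2)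
    (hX₁ : ClassX3Gord W₁ p) (he₁ : semistabilityIndex W₁ p = 2)
    (hX₂ : ClassX3Gord W₂ p) (he₂ : semistabilityIndex W₂ p = 2)
    (htors₁ : ¬ p ∣ W₁.torsionOrder) (hT : TorsionIso W₁ W₂ p)
    (S₀ : Finset (HeightOneSpectrum (𝓞 ℚ))) (hS₀ : ∀ w ∈ S₀, ((p : ℕ) : 𝓞 ℚ) ∉ w.asIdeal)
    (hS₁ : ∀ w : HeightOneSpectrum (𝓞 ℚ), w ∉ S₀ → ((p : ℕ) : 𝓞 ℚ) ∉ w.asIdeal →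
      W₁.HasGoodReductionAt w)
    (hS₂ : ∀ w : HeightOneSpectrum (𝓞 ℚ), w ∉ S₀ → ((p : ℕ) : 𝓞 ℚ) ∉ w.asIdeal →
      W₂.HasGoodReductionAt w) :
    CongruentLambdaShift W₁ W₂ p (∑ w ∈ S₀, ((delta W₂ p w : ℤ) - (delta W₁ p w : ℤ))) :=
  ClassX3Gord.congruentLambdaShift_of_gv_of_torsionIso₁ hGV hp2 hX₁ he₁ hX₂ he₂ htors₁
    (ClassX3Gord.ramifiedLineKummerEqAt hGrK hp2 hX₁ he₁)
    (ClassX3Gord.ramifiedLineKummerEqAt hGrK hp2 hX₂ he₂) hT S₀ hS₀ hS₁ hS₂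

/-- **X3♯(G-ord) ∩ `I₀*` congruent pairs, odd `p`: `μ(X(E₁)) = 0 ⟹ μ(X(E₂)) = 0`** from `hGV`, `hGrK`,
the class columns, `TorsionIso`, ONE census bit `p ∤ #E₁(ℚ)_tors` and `Σ₀`. Nothing booked.
[cite: GreenbergVatsal2000, §2 Prop. (2.8) with Remark (2.9), Cor. (2.3), pp. 26–27 (arXiv:math/9906215)]
[cite: GreenbergLNM1716, §2 Props. 2.2, 2.4 (pp. 73–75)] -/
theorem ClassX3Gord.mu_eq_zero_of_gv_of_grK_of_torsionIso
    (hGV : muLambdaAlg_transfer_of_torsionIso_potOrd_of_not_dvd_torsionOrder)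
    (hGrK : imKummer_ge_strictCondition_goodOrdinary) (hp2 : p ≠ 2)
    (hX₁ : ClassX3Gord W₁ p) (he₁ : semistabilityIndex W₁ p = 2)
    (hX₂ : ClassX3Gord W₂ p) (he₂ : semistabilityIndex W₂ p = 2)
    (htors₁ : ¬ p ∣ W₁.torsionOrder) (hT : TorsionIso W₁ W₂ p)
    (S₀ : Finset (HeightOneSpectrum (𝓞 ℚ))) (hS₀ : ∀ w ∈ S₀, ((p : ℕ) : 𝓞 ℚ) ∉ w.asIdeal)
    (hS₁ : ∀ w : HeightOneSpectrum (𝓞 ℚ), w ∉ S₀ → ((p : ℕ) : 𝓞 ℚ) ∉ w.asIdeal →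
      W₁.HasGoodReductionAt w)
    (hS₂ : ∀ w : HeightOneSpectrum (𝓞 ℚ), w ∉ S₀ → ((p : ℕ) : 𝓞 ℚ) ∉ w.asIdeal →
      W₂.HasGoodReductionAt w)
    {κ : ZpExtension ℚ p} {γ : absoluteGaloisGroup ℚ} (hκ : κ.IsCyclotomic)
    (hγ : κ.IsTopGenerator γ) (hγ' : IsCyclotomicVariable p γ)
    (D₁ : W₁.SelmerDualData κ γ) (D₂ : W₂.SelmerDualData κ γ)
    [Module.Finite (IwasawaAlgebra p) D₁.X] [Module.Finite (IwasawaAlgebra p) D₂.X]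
    (hX₁t : D₁.IsTorsion) (hX₂t : D₂.IsTorsion) (hμ₁ : D₁.mu = 0) : D₂.mu = 0 :=
  ClassX3Gord.mu_eq_zero_of_gv_of_torsionIso hGV hp2 hX₁ he₁ hX₂ he₂ htors₁
    (not_dvd_torsionOrder_of_torsionIso hT htors₁) (ClassX3Gord.ramifiedLineKummerEqAt hGrK hp2 hX₁ he₁)
    (ClassX3Gord.ramifiedLineKummerEqAt hGrK hp2 hX₂ he₂) hT S₀ hS₀ hS₁ hS₂ hκ hγ hγ' D₁ D₂ hX₁t hX₂t
    hμ₁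

/-- **X4♯(G-ord) ∩ `I₀*` congruent pairs (`p` odd is automatic): `CongruentLambdaShift W₁ W₂ p
(Σ_{w∈Σ₀} (δ(E₂,w) − δ(E₁,w)))` from `hGV` (A240) and `hGrK` (A239, through n1011-p05's
`ClassX4Gord.ramifiedLineKummerEqAt`) + the class columns + `TorsionIso` + `Σ₀` — NO torsion bit
(irreducibility), NO R-D binder, NO image binder; the EPW-free second source for Route G's X4♯(G-ord)
node with every local hypothesis in the kernel.** X4♯(G-ord) stays CONSTRUCTION-SHAPED; nothing booked.
[cite: GreenbergVatsal2000, §2 Prop. (2.8) with Remark (2.9), Cor. (2.3), Prop. (2.4), pp. 26–27 (arXiv:math/9906215)]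
[cite: GreenbergLNM1716, §2 Props. 2.2, 2.4 (pp. 73–75)] -/
theorem ClassX4Gord.congruentLambdaShift_of_gv_of_grK_of_torsionIso
    (hGV : muLambdaAlg_transfer_of_torsionIso_potOrd_of_not_dvd_torsionOrder)
    (hGrK : imKummer_ge_strictCondition_goodOrdinary)
    (hX₁ : ClassX4Gord W₁ p) (he₁ : semistabilityIndex W₁ p = 2)
    (hX₂ : ClassX4Gord W₂ p) (he₂ : semistabilityIndex W₂ p = 2) (hT : TorsionIso W₁ W₂ p)
    (S₀ : Finset (HeightOneSpectrum (𝓞 ℚ))) (hS₀ : ∀ w ∈ S₀, ((p : ℕ) : 𝓞 ℚ) ∉ w.asIdeal)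
    (hS₁ : ∀ w : HeightOneSpectrum (𝓞 ℚ), w ∉ S₀ → ((p : ℕ) : 𝓞 ℚ) ∉ w.asIdeal →
      W₁.HasGoodReductionAt w)
    (hS₂ : ∀ w : HeightOneSpectrum (𝓞 ℚ), w ∉ S₀ → ((p : ℕ) : 𝓞 ℚ) ∉ w.asIdeal →
      W₂.HasGoodReductionAt w) :
    CongruentLambdaShift W₁ W₂ p (∑ w ∈ S₀, ((delta W₂ p w : ℤ) - (delta W₁ p w : ℤ))) :=
  ClassX4Gord.congruentLambdaShift_of_gv_of_torsionIso hGV hX₁ he₁ hX₂ he₂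
    (ClassX4Gord.ramifiedLineKummerEqAt hGrK hX₁ he₁) (ClassX4Gord.ramifiedLineKummerEqAt hGrK hX₂ he₂)
    hT S₀ hS₀ hS₁ hS₂

/-- **X4♯(G-ord) ∩ `I₀*` congruent pairs: `μ(X(E₁)) = 0 ⟹ μ(X(E₂)) = 0`** from `hGV`, `hGrK`, the class
columns, `TorsionIso` and `Σ₀` — NO torsion / R-D / image binder. Nothing booked.
[cite: GreenbergVatsal2000, §2 Prop. (2.8) with Remark (2.9), Cor. (2.3), pp. 26–27 (arXiv:math/9906215)]
[cite: GreenbergLNM1716, §2 Props. 2.2, 2.4 (pp. 73–75)] -/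
theorem ClassX4Gord.mu_eq_zero_of_gv_of_grK_of_torsionIso
    (hGV : muLambdaAlg_transfer_of_torsionIso_potOrd_of_not_dvd_torsionOrder)
    (hGrK : imKummer_ge_strictCondition_goodOrdinary)
    (hX₁ : ClassX4Gord W₁ p) (he₁ : semistabilityIndex W₁ p = 2)
    (hX₂ : ClassX4Gord W₂ p) (he₂ : semistabilityIndex W₂ p = 2) (hT : TorsionIso W₁ W₂ p)
    (S₀ : Finset (HeightOneSpectrum (𝓞 ℚ))) (hS₀ : ∀ w ∈ S₀, ((p : ℕ) : 𝓞 ℚ) ∉ w.asIdeal)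
    (hS₁ : ∀ w : HeightOneSpectrum (𝓞 ℚ), w ∉ S₀ → ((p : ℕ) : 𝓞 ℚ) ∉ w.asIdeal →
      W₁.HasGoodReductionAt w)
    (hS₂ : ∀ w : HeightOneSpectrum (𝓞 ℚ), w ∉ S₀ → ((p : ℕ) : 𝓞 ℚ) ∉ w.asIdeal →
      W₂.HasGoodReductionAt w)
    {κ : ZpExtension ℚ p} {γ : absoluteGaloisGroup ℚ} (hκ : κ.IsCyclotomic)
    (hγ : κ.IsTopGenerator γ) (hγ' : IsCyclotomicVariable p γ)
    (D₁ : W₁.SelmerDualData κ γ) (D₂ : W₂.SelmerDualData κ γ)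
    [Module.Finite (IwasawaAlgebra p) D₁.X] [Module.Finite (IwasawaAlgebra p) D₂.X]
    (hX₁t : D₁.IsTorsion) (hX₂t : D₂.IsTorsion) (hμ₁ : D₁.mu = 0) : D₂.mu = 0 :=
  ClassX4Gord.mu_eq_zero_of_gv_of_torsionIso hGV hX₁ he₁ hX₂ he₂
    (ClassX4Gord.ramifiedLineKummerEqAt hGrK hX₁ he₁) (ClassX4Gord.ramifiedLineKummerEqAt hGrK hX₂ he₂)
    hT S₀ hS₀ hS₁ hS₂ hκ hγ hγ' D₁ D₂ hX₁t hX₂t hμ₁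

end Classes

end Summit.BirchSwinnertonDyer.Rank1Residual.Additive

end
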